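import Literature.MathematicalPhysics.QuantumManyBody.BoseGasSlabDepletion
import Literature.MathematicalPhysics.QuantumManyBody.BoseGasSlabDepletionFree
import HarnessLib

/-!
# Route `BECTangentRigidity`, crux `RigidMomentumBound` (stmt-AtomisticToContinuum-13034):
# stub `stub_slabNonConcentration` (F4) — wall depletion at a fixed distance

For every repulsive finite-range pair potential `v` there is `ρ₀ > 0` such that for
`0 < ρ < ρ₀` there is `s₁ > 0` (here `s₁ = 1`) such that for every slab width `0 < s ≤ s₁`, every
`θ > 0` and every window parameter `κ > 0`: eventually in `N`, uniformly for boxes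
`L' ∈ [L_N, (1 + κ/N) L_N]` (`L_N = (N/ρ)^{1/3}`), every `1`-near-minimiser `Φ` of the Dirichlet
energy of `N` bosons in `Λ_{L'}` has at most `θN` particles (in expectation) within `s` of any
right wall: `∑ⱼ ∫_{x_{j,a} > L' - s} |Φ|² ≤ θ N`.

Proof: dichotomy on the scattering length `a` of `v`.

* `a > 0` (`Literature/…/BoseGasSlabDepletion.lean`,
  `slabNonConcentration_of_scatteringLength_pos`): IMS localisation of `Φ` across a ramp of width
  `δ` into a bulk piece and an upper layer of thickness `ℓ ∈ [ℓ₀, 2ℓ₀]` below the wall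
  (`BoseGasSlabLocalization.lean`); the bulk piece is an UNCONSTRAINED Dirichlet group (no
  artificial boundary condition), the layer is bracketed into Neumann cells of side `ℓ`
  (`BoseGasMixedCellFloor.lean`, `BoseGasSlabBracketing.lean`); the Neumann cells carry the linear
  crowding penalty `P = 2πaρ_h` per particle from the Lieb–Yngvason bound and superadditivity
  (`BoseGasCrowdedCellPenalty.lean`), the bulk group is bounded below by the supporting line of
  the CONVEX thermodynamic energy density (Ruelle's subadditivity plus continuity:
  `BoseGasEnergyDensityConvexity.lean`), whose slope `≤ 2e⁺(2ρ) ≤ P/4` at small `ρ` (Dyson's upper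
  bound); the `o(N)` precision of `E₀^D(N, L_N)` (existence of the Dirichlet thermodynamic limit)
  and the continuity of `e⁺` at `ρ` close the budget (`BoseGasSlabDepletionCore.lean`).
* `a = 0` (`Literature/…/BoseGasSlabDepletionFree.lean`,
  `slabNonConcentration_of_scatteringLength_eq_zero`): then `v = 0` a.e. (LSSY App. C), the
  interaction is invisible, and the free Dirichlet gap on every coordinate line
  (`BoseGasLineSineGap.lean`, `BoseGasConfigLineGap.lean`) together with the sharp free upper
  bound `E₀^D(0, N, L) ≤ 3Nπ²(1+η)/L²` from a near-optimal `C¹` product state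
  (`BoseGasSinePlateau.lean`, `BoseGasSineProfileIntegrals.lean`, `BoseGasFreeProductState.lean`)
  give the slab bound `(4π²s³/(3L'³) + 2η)N + 2L'²/(3π²) ≤ θN`.

References: LSSY 2005, Thm. 2.2, Thm. 2.4, (2.52)–(2.58), App. C; Ruelle 1969, §3.5.11.
-/

noncomputable section

namespace Summit.AtomisticToContinuum.BoseEinsteinCondensation.Theorems.RigidMomentumBound

open MeasureTheory Filter Set
open scoped ENNReal NNReal BigOperators
open Literature.MathematicalPhysics.QuantumManyBody.BoseGas

/-- **F4 `stub_slabNonConcentration` — wall depletion at a fixed distance.** For every repulsive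
finite-range `v` there is `ρ₀ > 0` such that for `0 < ρ < ρ₀` there is `s₁ > 0` with: for every
`0 < s ≤ s₁`, `θ > 0`, `κ > 0`, eventually in `N`, for every `L' ∈ [L_N, (1+κ/N)L_N]`, every
Dirichlet trial state `Φ` of `N` bosons in `Λ_{L'}` with `⟨Φ,HΦ⟩ ≤ E₀^D(N, L') + 1` and every
direction `a`, `∑ⱼ ∫_{x_{j,a} > L'-s} |Φ|² ≤ θN`. Dichotomy on the scattering length:
`slabNonConcentration_of_scatteringLength_pos` (IMS localisation, mixed Dirichlet/Neumann cell
floor, crowding penalty, convexity of the thermodynamic energy density, Dirichlet thermodynamic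
limit) and `slabNonConcentration_of_scatteringLength_eq_zero` (free Dirichlet gap and the sharp
free upper bound); `s₁ = 1`. [cite: LSSY2005, Thm. 2.2, Thm. 2.4, (2.52)–(2.58) and App. C] -/
theorem stub_slabNonConcentration :
    ∀ v : ℝ → ℝ≥0∞, IsRepulsiveFiniteRange v → ∃ ρ₀ : ℝ, 0 < ρ₀ ∧ ∀ ρ : ℝ, 0 < ρ → ρ < ρ₀ →
      ∃ s₁ : ℝ, 0 < s₁ ∧ ∀ s : ℝ, 0 < s → s ≤ s₁ → ∀ θ : ℝ, 0 < θ → ∀ κ : ℝ, 0 < κ →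
        ∀ᶠ N : ℕ in atTop, ∀ L' ∈ Set.Icc (sideLength ρ N) ((1 + κ / N) * sideLength ρ N),
          ∀ Φ : TrialState N L', energy v Φ ≤ groundStateEnergy v N L' + 1 →
            ∀ a : Fin 3, (∑ j : Fin N, ∫⁻ X in {X : Config N | L' - s < X j a},
                (‖Φ.ψ X‖₊ : ℝ≥0∞) ^ 2) ≤ ENNReal.ofReal (θ * N) := by
  intro v hv
  rcases eq_or_ne (scatteringLength v) 0 with ha0 | ha0
  · refine ⟨1, one_pos, fun ρ hρ _ => ⟨1, one_pos, fun s hs hs1 θ hθ κ _ => ?_⟩⟩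
    exact slabNonConcentration_of_scatteringLength_eq_zero hv ha0 hρ hs hs1 hθ κ
  · obtain ⟨ρ₀, hρ₀, H⟩ := slabNonConcentration_of_scatteringLength_pos hv (pos_iff_ne_zero.2 ha0)
    exact ⟨ρ₀, hρ₀, fun ρ hρ hρlt => ⟨1, one_pos, fun s hs hs1 θ hθ κ hκ =>
      H ρ hρ hρlt s hs hs1 θ hθ κ hκ⟩⟩

end Summit.AtomisticToContinuum.BoseEinsteinCondensation.Theorems.RigidMomentumBound

end
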